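import Summits.QuantumFields.YangMills.Theorems.BalabanLadderUVSeamRecCeilingsResponseCarriersUnit
import Summits.QuantumFields.YangMills.Theorems.BalabanLadderUVSeamRecCeilingsSubGaussianCarrier
import HarnessLib

/-!
# Crux `UVSeamRec` (stmt-QuantumFields-20043): (EM_Q) ⇐ (EM_lin) in the route's currency, and the composition BY NAME
# with the registered v5(α) stub body

Helper file (`--supports stmt-QuantumFields-20043`) of the LEAD seat `ym-spine-20043-p1` (gen 8); sequel of
`…CeilingsSubGaussianCarrier.lean` (abstract Hubbard–Stratonovich theorem `integral_exp_mul_sum_sq_le_of_subGaussianLinear`).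

* §3 `torusE_exp_mul_sum_sq_le_of_subGaussianLinear` (torus form), `emQ_of_subGaussianLinear` — the hypothesis `hEMQ` of
  p535725 `responseMoments_of_quadratic_and_polymerLaw` for the quadratic carrier `Q := λℓ²` from the extensive sub-Gaussian
  LINEAR-source bound (EM_lin) `⟨exp(Σ_{i∈T} t_i ℓ_i)⟩_{2L+1,β} ≤ exp(mΣ|t_i| + (v/2)Σt_i²)` (all source vectors `t`), with
  `B_Q = log(2(1−4λv)^{-1/2}exp(2λm²/(1−4λv)))`; `measurable_quadraticCarrier`, `abs_quadraticCarrier_le`.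
* §4 `responseMomentsOdd6_of_subGaussianLinear_and_polymerLaw` — (split with `Q = λℓ²`) + (EM_lin) + (PL) ⇒ the body of
  `BirthV5A.stub_responseMomentsOdd6` VERBATIM (via p539259 `responseMomentsOdd6_of_quadratic_and_polymerLaw`).

Why this shape: (EM_lin) is the canonical output of a convergent expansion (analyticity and extensivity of the torus free energy
in LINEAR local sources `Σ t_i ℓ_i`), and its `ℓ²`-term `(v/2)Σt_i²` is exactly the operator-norm bound on the covariance of the
flux statistics restricted to separated families (ceilings-p2 note #54 §2: the `ℓ¹`/Gershgorin budget diverges like `log(L/R)` for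
dipole influence in `d = 4`; the operator norm does not).  HONEST FRAMING: composition only; (split) (= E0′-K with background),
(EM_lin) (Gaussian domination of the flux statistic under the Wilson state, uniformly for `R ≤ ℓ₁/a(β)`), (PL) (Bałaban large
fields at levels `k ≥ 1` on odd tori) are OPEN; nothing of E0′; not a gap, not Clay.

References: p535725 / p539259 (carriers press-buttons); Georgii (2011) Thm. 4.17 for the DLR vocabulary.
-/

set_option autoImplicit false

noncomputable section

open MeasureTheory ProbabilityTheory Finset

namespace Summit.QuantumFields.YangMills.Cruxes.UVSeamRec.TemperedResponse

/-! ## §3 The press-button at the torus state: (EM_Q) for `Q = λℓ²` from (EM_lin) -/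

section Route

open Literature.MathematicalPhysics.QuantumFieldTheory (GaugeConfig wilsonMeasure isProbabilityMeasure_wilsonMeasure
  measurable_torusLift LatticeRep)
open Literature.MathematicalPhysics.QuantumLattice
open Summit.QuantumFields.YangMills.Cruxes.OSLegsFromFemtoAndGap.DlrCollarTransfer

variable {G : Type} [Group G] [TopologicalSpace G] [IsTopologicalGroup G] [CompactSpace G]
  [MeasurableSpace G] [BorelSpace G] (r : LatticeRep G) (a : ℝ → ℝ)

/-- **Torus form.**  On the torus of side `2L+1` at coupling `β`, for bounded measurable statistics `f_i` of the periodic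
lift (`i ∈ T ⊆ Fin n`), `λ ≥ 0`, `2λv < 1`: the extensive sub-Gaussian linear-source bound
`⟨exp(Σ_{i∈T} t_i f_i)⟩ ≤ exp(mΣ_{i∈T}|t_i| + (v/2)Σ_{i∈T}t_i²)` for all `t : Fin n → ℝ` gives
`⟨exp(λΣ_{i∈T} f_i²)⟩ ≤ (2(1−2λv)^{-1/2}exp(λm²/(1−2λv)))^{#T}`. [folklore] -/
theorem torusE_exp_mul_sum_sq_le_of_subGaussianLinear (β : ℝ) (L : ℕ) {n : ℕ} (T : Finset (Fin n))
    (f : Fin n → LGConfig 4 G → ℝ) (hfm : ∀ i, Measurable (f i)) {M : ℝ} (hfb : ∀ i η, |f i η| ≤ M)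
    {m v lam : ℝ} (hlam : 0 ≤ lam) (h2 : 2 * lam * v < 1)
    (hlin : ∀ t : Fin n → ℝ, torusE G r β L (fun U => Real.exp (∑ i ∈ T, t i * f i U)) ≤
      Real.exp (m * ∑ i ∈ T, |t i| + v / 2 * ∑ i ∈ T, (t i) ^ 2)) :
    torusE G r β L (fun U => Real.exp (lam * ∑ i ∈ T, (f i U) ^ 2)) ≤
      (2 * (Real.sqrt (1 / (1 - 2 * (lam * v))) * Real.exp (lam * m ^ 2 / (1 - 2 * (lam * v))))) ^ T.card := by
  haveI := isProbabilityMeasure_wilsonMeasure (d := 4) (L := 2 * L + 1) r.ρ r.continuous β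
  set μ := wilsonMeasure (d := 4) (L := 2 * L + 1) r.ρ β with hμ
  -- statistics indexed by the subtype `T`
  set ℓ : T → GaugeConfig 4 (2 * L + 1) G → ℝ := fun i U => f i (torusLift (2 * L + 1) U) with hℓ
  have hℓm : ∀ i, Measurable (ℓ i) := fun i => (hfm i).comp (measurable_torusLift _)
  have hℓb : ∀ i U, |ℓ i U| ≤ M := fun i U => hfb i _
  have hlin' : ∀ t : T → ℝ, ∫ U, Real.exp (∑ i, t i * ℓ i U) ∂μ ≤
      Real.exp (m * ∑ i, |t i| + v / 2 * ∑ i, (t i) ^ 2) := by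
    intro t
    classical
    set t' : Fin n → ℝ := fun i => if h : i ∈ T then t ⟨i, h⟩ else 0 with ht'
    have h := hlin t'
    have e1 : ∀ U : LGConfig 4 G, ∑ i ∈ T, t' i * f i U = ∑ i : T, t i * f i U := by
      intro U
      rw [← Finset.sum_coe_sort]
      refine Finset.sum_congr rfl fun i _ => ?_
      rw [ht']; simp only [Finset.coe_mem, ↓reduceDIte]
    have e2 : ∑ i ∈ T, |t' i| = ∑ i : T, |t i| := by
      rw [← Finset.sum_coe_sort]
      refine Finset.sum_congr rfl fun i _ => ?_
      rw [ht']; simp only [Finset.coe_mem, ↓reduceDIte]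
    have e3 : ∑ i ∈ T, (t' i) ^ 2 = ∑ i : T, (t i) ^ 2 := by
      rw [← Finset.sum_coe_sort]
      refine Finset.sum_congr rfl fun i _ => ?_
      rw [ht']; simp only [Finset.coe_mem, ↓reduceDIte]
    simp only [torusE, e1, e2, e3] at h
    exact h
  have h := integral_exp_mul_sum_sq_le_of_subGaussianLinear μ ℓ hℓm hℓb hlam h2 hlin'
  rw [Fintype.card_coe] at h
  simp only [torusE]
  refine le_of_eq_of_le ?_ h
  refine integral_congr_ae (Filter.Eventually.of_forall fun U => ?_)
  simp only [hℓ]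
  rw [← Finset.sum_coe_sort]

/-- **(EM_Q) ⇐ (EM_lin) in the route's currency.**  For a LINEAR flux statistic
`ℓ β R q x : LGConfig 4 G → ℝ` of the exterior of the radius-`R+1` cube around `x` (orientation `q`), measurable and bounded, and
the QUADRATIC carrier `Q := λ·ℓ²` (`λ ≥ 0`, `4λv < 1`): the extensive sub-Gaussian linear-source bound (EM_lin) on every odd torus
`(ℤ/(2L+1))⁴`, `4R+8 ≤ L`, every cyclically `2R+4`-separated family, every `T` and every source vector `t` gives the doubled joint
exponential moments (EM_Q) `⟨exp(2·Σ_{i∈T} Q_i)⟩ ≤ exp(B_Q·#T)` VERBATIM as consumed by p535725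
`responseMoments_of_quadratic_and_polymerLaw` (hypothesis `hEMQ`), with
`B_Q = log(2 (1−4λv)^{-1/2} exp(2λm²/(1−4λv)))`. [folklore] -/
theorem emQ_of_subGaussianLinear {β₁ ℓ₁ : ℝ}
    (ℓ : ℝ → ℕ → Fin 4 × Fin 4 → (Fin 4 → ℤ) → LGConfig 4 G → ℝ) (Mℓ : ℝ → ℕ → ℝ)
    (hℓm : ∀ β R q x, Measurable (ℓ β R q x)) (hℓb : ∀ β R q x η, |ℓ β R q x η| ≤ Mℓ β R)
    {m v lam : ℝ} (hlam : 0 ≤ lam) (h4 : 4 * lam * v < 1)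
    (hEMlin : ∀ β : ℝ, β₁ ≤ β → ∀ (L n : ℕ) (q : Fin n → Fin 4 × Fin 4) (x : Fin n → (Fin 4 → ℤ)) (R : ℕ),
      (∀ i, (q i).1 < (q i).2) → 1 ≤ R → (R : ℝ) * a β ≤ ℓ₁ → 4 * R + 8 ≤ L →
      (∀ i j : Fin n, i ≠ j → ∃ k : Fin 4,
        (2 * (R : ℤ) + 4) ≤ |((((x i k - x j k : ℤ) : ZMod (2 * L + 1))).valMinAbs : ℤ)|) →
      ∀ (T : Finset (Fin n)) (t : Fin n → ℝ),
        torusE G r β L (fun U => Real.exp (∑ i ∈ T, t i * ℓ β R (q i) (x i) U)) ≤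
          Real.exp (m * ∑ i ∈ T, |t i| + v / 2 * ∑ i ∈ T, (t i) ^ 2)) :
    ∀ β : ℝ, β₁ ≤ β → ∀ (L n : ℕ) (q : Fin n → Fin 4 × Fin 4) (x : Fin n → (Fin 4 → ℤ)) (R : ℕ),
      (∀ i, (q i).1 < (q i).2) → 1 ≤ R → (R : ℝ) * a β ≤ ℓ₁ → 4 * R + 8 ≤ L →
      (∀ i j : Fin n, i ≠ j → ∃ k : Fin 4,
        (2 * (R : ℤ) + 4) ≤ |((((x i k - x j k : ℤ) : ZMod (2 * L + 1))).valMinAbs : ℤ)|) →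
      ∀ T : Finset (Fin n),
        torusE G r β L (fun U => Real.exp (((2 : ℕ) : ℝ) * ∑ i ∈ T, lam * (ℓ β R (q i) (x i) U) ^ 2)) ≤
          Real.exp (Real.log (2 * (Real.sqrt (1 / (1 - 4 * (lam * v))) *
            Real.exp (2 * lam * m ^ 2 / (1 - 4 * (lam * v))))) * T.card) := by
  intro β hβ L n q x R hq hR hRa hL hsep T
  have hX : 0 < 2 * (Real.sqrt (1 / (1 - 4 * (lam * v))) * Real.exp (2 * lam * m ^ 2 / (1 - 4 * (lam * v)))) := by
    have : 0 < 1 - 4 * (lam * v) := by linarith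
    positivity
  rw [mul_comm (Real.log _) _, Real.exp_nat_mul, Real.exp_log hX]
  have h := torusE_exp_mul_sum_sq_le_of_subGaussianLinear r β L T (fun i => ℓ β R (q i) (x i))
    (fun i => hℓm β R (q i) (x i)) (fun i η => hℓb β R (q i) (x i) η) (m := m) (v := v) (lam := 2 * lam)
    (by positivity) (by linarith) (hEMlin β hβ L n q x R hq hR hRa hL hsep T)
  have e1 : (1 : ℝ) - 2 * (2 * lam * v) = 1 - 4 * (lam * v) := by ring
  rw [e1] at h
  refine le_of_eq_of_le ?_ h
  congr 1
  funext U
  congr 1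
  rw [Finset.mul_sum, Finset.mul_sum]
  refine Finset.sum_congr rfl fun i _ => ?_
  push_cast
  ring

omit [Group G] [TopologicalSpace G] [IsTopologicalGroup G] [CompactSpace G] [BorelSpace G] in
/-- Measurability of the quadratic carrier `Q = λℓ²`. [folklore] -/
theorem measurable_quadraticCarrier (ℓ : ℝ → ℕ → Fin 4 × Fin 4 → (Fin 4 → ℤ) → LGConfig 4 G → ℝ)
    (hℓm : ∀ β R q x, Measurable (ℓ β R q x)) (lam : ℝ) (β : ℝ) (R : ℕ) (q : Fin 4 × Fin 4) (x : Fin 4 → ℤ) :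
    Measurable (fun η => lam * (ℓ β R q x η) ^ 2) :=
  ((hℓm β R q x).pow_const 2).const_mul lam

omit [Group G] [TopologicalSpace G] [IsTopologicalGroup G] [CompactSpace G] [MeasurableSpace G] [BorelSpace G] in
/-- Boundedness of the quadratic carrier `Q = λℓ²`: `|λℓ²| ≤ |λ|·M²`. [folklore] -/
theorem abs_quadraticCarrier_le (ℓ : ℝ → ℕ → Fin 4 × Fin 4 → (Fin 4 → ℤ) → LGConfig 4 G → ℝ) (Mℓ : ℝ → ℕ → ℝ)
    (hℓb : ∀ β R q x η, |ℓ β R q x η| ≤ Mℓ β R) (lam : ℝ) (β : ℝ) (R : ℕ) (q : Fin 4 × Fin 4) (x : Fin 4 → ℤ)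
    (η : LGConfig 4 G) : |lam * (ℓ β R q x η) ^ 2| ≤ |lam| * (Mℓ β R) ^ 2 := by
  rw [abs_mul, abs_pow]
  exact mul_le_mul_of_nonneg_left (pow_le_pow_left₀ (abs_nonneg _) (hℓb β R q x η) 2) (abs_nonneg _)

end Route

/-! ## §4 Composition BY NAME with the registered v5(α) stub body (`SU(2)`, fundamental representation, unit `≤ c·uRec`) -/

section Unit

open Literature.MathematicalPhysics.QuantumFieldTheory (GaugeConfig LatticeRep)
open Literature.MathematicalPhysics.QuantumLattice
open Summit.QuantumFields.YangMills.Cruxes.OSLegsFromFemtoAndGap.DlrCollarTransfer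
open Filter

variable [MeasurableSpace (Matrix.specialUnitaryGroup (Fin 2) ℂ)] [BorelSpace (Matrix.specialUnitaryGroup (Fin 2) ℂ)]

/-- **The body of `stub_responseMomentsOdd6` from (split) with a QUADRATIC-OF-LINEAR carrier + (EM_lin) + (PL).**  Data at
`SU(2)`, fundamental representation, unit `a ≤ c·uRec` eventually: a linear flux statistic `ℓ` (measurable, bounded by `Mℓ β R`),
`λ ≥ 0` with `4λv < 1`, a large-field carrier `LF` (measurable, bounded by `MLF β R`); (split) for ALL exteriors with
`Q := λℓ²`; (EM_lin) the extensive sub-Gaussian linear-source bound for `ℓ` on every odd torus and separated family; (PL) the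
polymer product law for `LF` (p528131's typing).  THEN the registered stub's conclusion holds with
`B = A₀ + max(log(2(1−4λv)^{-1/2}e^{2λm²/(1−4λv)}), 2e^{2Λ}W)` — by `emQ_of_subGaussianLinear` and p539259
`responseMomentsOdd6_of_quadratic_and_polymerLaw`.  HONEST FRAMING: composition; (split), (EM_lin), (PL) are OPEN. [folklore] -/
theorem responseMomentsOdd6_of_subGaussianLinear_and_polymerLaw {a : ℝ → ℝ} {c C₁ β₁ ℓ₁ A₀ Λ W P₀ : ℝ}
    {p : Fin 4 × Fin 4 → ℝ → ℝ} (hc : 0 < c) (hle : ∀ᶠ β in atTop, a β ≤ c * Transport.uRec β) (hℓ₁ : 0 < ℓ₁)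
    (hC₁ : 0 < C₁) (hp : ∀ q β, |p q β| ≤ P₀)
    (ℓ LF : ℝ → ℕ → Fin 4 × Fin 4 → (Fin 4 → ℤ) → LGConfig 4 (Matrix.specialUnitaryGroup (Fin 2) ℂ) → ℝ)
    (Mℓ MLF : ℝ → ℕ → ℝ)
    (hℓm : ∀ β R q x, Measurable (ℓ β R q x)) (hℓb : ∀ β R q x η, |ℓ β R q x η| ≤ Mℓ β R)
    (hLFm : ∀ β R q x, Measurable (LF β R q x)) (hLFb : ∀ β R q x η, |LF β R q x η| ≤ MLF β R)
    {m v lam : ℝ} (hlam : 0 ≤ lam) (h4 : 4 * lam * v < 1)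
    (hsplit : ∀ β : ℝ, β₁ ≤ β → ∀ R : ℕ, 1 ≤ R → (R : ℝ) * a β ≤ ℓ₁ →
      ∀ (q : Fin 4 × Fin 4) (x : Fin 4 → ℤ), q.1 < q.2 → ∀ η : LGConfig 4 (Matrix.specialUnitaryGroup (Fin 2) ℂ),
        (R : ℝ) ^ 4 / C₁ * |kerE (Matrix.specialUnitaryGroup (Fin 2) ℂ) (fundamentalLatticeRep 2) β (fun k => x k - (R + 1)) (2 * R + 3) η
          (plane (Matrix.specialUnitaryGroup (Fin 2) ℂ) (fundamentalLatticeRep 2) q x) - p q β| ≤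
            A₀ + lam * (ℓ β R q x η) ^ 2 + LF β R q x η)
    (hEMlin : ∀ β : ℝ, β₁ ≤ β → ∀ (L n : ℕ) (q : Fin n → Fin 4 × Fin 4) (x : Fin n → (Fin 4 → ℤ)) (R : ℕ),
      (∀ i, (q i).1 < (q i).2) → 1 ≤ R → (R : ℝ) * a β ≤ ℓ₁ → 4 * R + 8 ≤ L →
      (∀ i j : Fin n, i ≠ j → ∃ k : Fin 4,
        (2 * (R : ℤ) + 4) ≤ |((((x i k - x j k : ℤ) : ZMod (2 * L + 1))).valMinAbs : ℤ)|) →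
      ∀ (T : Finset (Fin n)) (t : Fin n → ℝ),
        torusE (Matrix.specialUnitaryGroup (Fin 2) ℂ) (fundamentalLatticeRep 2) β L
          (fun U => Real.exp (∑ i ∈ T, t i * ℓ β R (q i) (x i) U)) ≤
            Real.exp (m * ∑ i ∈ T, |t i| + v / 2 * ∑ i ∈ T, (t i) ^ 2))
    (hPL : ∀ β : ℝ, β₁ ≤ β → ∀ (L n : ℕ) (q : Fin n → Fin 4 × Fin 4) (x : Fin n → (Fin 4 → ℤ)) (R : ℕ),
      (∀ i, (q i).1 < (q i).2) → 1 ≤ R → (R : ℝ) * a β ≤ ℓ₁ → 4 * R + 8 ≤ L →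
      (∀ i j : Fin n, i ≠ j → ∃ k : Fin 4,
        (2 * (R : ℤ) + 4) ≤ |((((x i k - x j k : ℤ) : ZMod (2 * L + 1))).valMinAbs : ℤ)|) →
      ∃ (κ : Type) (S : Finset κ) (E : κ → Set (LGConfig 4 (Matrix.specialUnitaryGroup (Fin 2) ℂ))) (w : κ → ℝ) (cf : Fin n → κ → ℝ),
        (∀ γ, MeasurableSet (E γ)) ∧ (∀ γ ∈ S, 0 ≤ w γ) ∧ (∀ i, ∀ γ ∈ S, 0 ≤ cf i γ) ∧
        (∀ (i : Fin n) (U : GaugeConfig 4 (2 * L + 1) (Matrix.specialUnitaryGroup (Fin 2) ℂ)),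
          LF β R (q i) (x i) (torusLift (2 * L + 1) U) ≤
            ∑ γ ∈ S, cf i γ * (E γ).indicator (fun _ => (1 : ℝ)) (torusLift (2 * L + 1) U)) ∧
        (∀ γ ∈ S, ∑ i, cf i γ ≤ Λ) ∧ (∀ i, ∑ γ ∈ S, cf i γ * w γ ≤ W) ∧
        (∀ A, A ⊆ S → torusE (Matrix.specialUnitaryGroup (Fin 2) ℂ) (fundamentalLatticeRep 2) β L
          (fun U => ∏ γ ∈ A, (E γ).indicator (fun _ => (1 : ℝ)) U) ≤ ∏ γ ∈ A, w γ)) :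
    ∃ (a : ℝ → ℝ) (c : ℝ) (C₁ B β₁ ℓ₁ P₀ : ℝ) (p : Fin 4 × Fin 4 → ℝ → ℝ), 0 < c ∧
      (∀ᶠ β in atTop, a β ≤ c * Transport.uRec β) ∧ 0 < ℓ₁ ∧ 0 < C₁ ∧ (∀ q β, |p q β| ≤ P₀) ∧
      ∀ β : ℝ, β₁ ≤ β → ∀ (L n : ℕ) (q : Fin n → Fin 4 × Fin 4) (x : Fin n → (Fin 4 → ℤ)) (R : ℕ),
        (∀ i, (q i).1 < (q i).2) → 1 ≤ R → (R : ℝ) * a β ≤ ℓ₁ → 4 * R + 8 ≤ L →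
        (∀ i j : Fin n, i ≠ j → ∃ k : Fin 4,
          (2 * (R : ℤ) + 4) ≤ |((((x i k - x j k : ℤ) : ZMod (2 * L + 1))).valMinAbs : ℤ)|) →
        ∀ T : Finset (Fin n),
          torusE (Matrix.specialUnitaryGroup (Fin 2) ℂ) (fundamentalLatticeRep 2) β L
            (fun U => Real.exp (∑ i ∈ T, (R : ℝ) ^ 4 / C₁ *
              |kerE (Matrix.specialUnitaryGroup (Fin 2) ℂ) (fundamentalLatticeRep 2) β (fun k => x i k - (R + 1)) (2 * R + 3) U
                (plane (Matrix.specialUnitaryGroup (Fin 2) ℂ) (fundamentalLatticeRep 2) (q i) (x i)) - p (q i) β|)) ≤ Real.exp (B * T.card) :=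
  responseMomentsOdd6_of_quadratic_and_polymerLaw hc hle hℓ₁ hC₁ hp
    (fun β R q x η => lam * (ℓ β R q x η) ^ 2) LF (fun β R => max (|lam| * (Mℓ β R) ^ 2) (MLF β R))
    (fun β R q x => measurable_quadraticCarrier ℓ hℓm lam β R q x)
    (fun β R q x η => (abs_quadraticCarrier_le ℓ Mℓ hℓb lam β R q x η).trans (le_max_left _ _))
    hLFm (fun β R q x η => (hLFb β R q x η).trans (le_max_right _ _)) hsplit
    (emQ_of_subGaussianLinear (fundamentalLatticeRep 2) a ℓ Mℓ hℓm hℓb hlam h4 hEMlin) hPL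

end Unit

end Summit.QuantumFields.YangMills.Cruxes.UVSeamRec.TemperedResponse

end
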